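import Summits.AtomisticToContinuum.HydrodynamicLimit.Theorems.RelayRaceLocalityNearConstantShortTimeHLTiltL2Defs
import Summits.AtomisticToContinuum.HydrodynamicLimit.Theorems.RelayRaceLocalityNearConstantShortTimeHLGeneralFamilyConcentrationContraction
import Summits.AtomisticToContinuum.HydrodynamicLimit.Theorems.AntiMazurCoboundariesCellForecastPressureDecayContactStatisticsSum
import HarnessLib

/-!
# Lipschitz dependence of the insertion ratios on the particle number (`InsertionRatioLipschitz`)

Support file for the crux `…Theses.RelayRaceLocality.NearConstantShortTimeHL` (stmt-AtomisticToContinuum-12502),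
line `small-tilt-domination`, registered stub `tl_insertionRatioLipschitz : InsertionRatioLipschitz` of the `L²`
route to `BallTiltLogLaplace` (`…TiltL2Defs`).

For the canonical hard-core gas of `n` labels with one-particle law `μ_P` at scale `ε` under the smallness
`n p_ε ≤ λ` (`p_ε = M v₁ ε³`), the inverse insertion factors `q(m) = Ξ(m)/Ξ(m+1) ∈ [1, 2]` satisfy
`|q(m+1) - q(m)| ≤ B/(m+1)` for `m + 1 < n` (here `λ = 1/1000`, `B = 1`). Proof: the ratio identity
`1/q(m) = Σ_j C(m,j) W¹(j+1) Ξ(m-j)/Ξ(m)` (`gf_inv_q_eq_sum`) at `m` and `m+1`, Pascal's rule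
(`tlq_pascal_sum`, `tlq_inv_q_sub_eq`), the tree bounds `C(m,j)|W¹(j+1)| ≤ e (eλ)ʲ` and
`C(m,i)|W¹(i+2)| ≤ p_ε e² (i+1) (eλ)ⁱ` (`tlq_abs_coef_succ_le`), the increments of the ratio products
`Ξ(m+1-j)/Ξ(m+1) - Ξ(m-j)/Ξ(m)` in terms of the increments `q(k+1) - q(k)`, `k < m` (`tlq_abs_r_sub_r_le`), and a
strong induction on `m` (`tlq_step`); finally `|q - q'| ≤ 4 |1/q - 1/q'|` for `q, q' ∈ (0, 2]`.

No definitions. Source: E. Pulvirenti – D. Tsagkarogiannis, Comm. Math. Phys. 316 (2012) 289–306, §5.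
-/

noncomputable section

namespace Summit.AtomisticToContinuum.HydrodynamicLimit.Theorems.NearConstantShortTimeHL

open MeasureTheory ProbabilityTheory Finset Filter Topology
open scoped ENNReal
open Literature.MathematicalPhysics.KineticTheory Literature.MathematicalPhysics.StatisticalMechanics
open Literature.Probability.LatticeModels

/-! ### Elementary facts -/

/-- **Pascal's rule inside the ratio identity**:
`Σ_{j ≤ m+1} C(m+1,j) W(j+1) r(j) = Σ_{j ≤ m} C(m,j) W(j+1) r(j) + Σ_{i ≤ m} C(m,i) W(i+2) r(i+1)`. [folklore] -/
theorem tlq_pascal_sum (m : ℕ) (W r : ℕ → ℝ) :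
    ∑ j ∈ range (m + 1 + 1), ((m + 1).choose j : ℝ) * W (j + 1) * r j =
      ∑ j ∈ range (m + 1), (m.choose j : ℝ) * W (j + 1) * r j +
        ∑ i ∈ range (m + 1), (m.choose i : ℝ) * W (i + 1 + 1) * r (i + 1) := by
  rw [sum_range_succ', sum_range_succ' (fun j => (m.choose j : ℝ) * W (j + 1) * r j)]
  have h1 : ∑ i ∈ range (m + 1), ((m + 1).choose (i + 1) : ℝ) * W (i + 1 + 1) * r (i + 1) =
      ∑ i ∈ range (m + 1), (m.choose i : ℝ) * W (i + 1 + 1) * r (i + 1) +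
        ∑ i ∈ range (m + 1), (m.choose (i + 1) : ℝ) * W (i + 1 + 1) * r (i + 1) := by
    rw [← sum_add_distrib]
    refine sum_congr rfl fun i _ => ?_
    rw [Nat.choose_succ_succ', Nat.cast_add]
    ring
  have h2 : ∑ i ∈ range (m + 1), (m.choose (i + 1) : ℝ) * W (i + 1 + 1) * r (i + 1) =
      ∑ i ∈ range m, (m.choose (i + 1) : ℝ) * W (i + 1 + 1) * r (i + 1) := by
    rw [sum_range_succ, Nat.choose_succ_self, Nat.cast_zero, zero_mul, zero_mul, add_zero]
  rw [h1, h2, Nat.choose_zero_right, Nat.choose_zero_right]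
  ring

/-- Numerics of the constants `λ = 1/1000`, `B = 1`: `4eλ < 1` and
`4 (2e²λ/(1-4eλ) + 4e²λ/(1-4eλ)² · 1) ≤ 1`. [folklore] -/
theorem tlq_numerics : 4 * Real.exp 1 * (1 / 1000 : ℝ) < 1 ∧
    4 * (2 * Real.exp 1 ^ 2 * (1 / 1000) / (1 - 4 * Real.exp 1 * (1 / 1000)) +
      4 * Real.exp 1 ^ 2 * (1 / 1000) / (1 - 4 * Real.exp 1 * (1 / 1000)) ^ 2 * 1) ≤ 1 := by
  have he1 : Real.exp 1 < 3 := lt_trans Real.exp_one_lt_d9 (by norm_num)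
  have he0 : 0 < Real.exp 1 := Real.exp_pos 1
  have hρ : 4 * Real.exp 1 * (1 / 1000 : ℝ) < 12 / 1000 := by linarith
  refine ⟨by linarith, ?_⟩
  have hd : (1 : ℝ) / 2 ≤ 1 - 4 * Real.exp 1 * (1 / 1000) := by linarith
  have he2 : Real.exp 1 ^ 2 ≤ 9 := by nlinarith
  have h1 : 2 * Real.exp 1 ^ 2 * (1 / 1000) / (1 - 4 * Real.exp 1 * (1 / 1000)) ≤
      2 * 9 * (1 / 1000) / (1 / 2) :=
    div_le_div₀ (by positivity) (by nlinarith) (by norm_num) hd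
  have h2 : 4 * Real.exp 1 ^ 2 * (1 / 1000) / (1 - 4 * Real.exp 1 * (1 / 1000)) ^ 2 * 1 ≤
      4 * 9 * (1 / 1000) / (1 / 2) ^ 2 * 1 := by
    rw [mul_one, mul_one]
    exact div_le_div₀ (by positivity) (by nlinarith) (by norm_num) (pow_le_pow_left₀ (by norm_num) hd 2)
  norm_num at h1 h2 ⊢
  linarith

/-! ### Bounds at a fixed scale `ε` and particle number `n` with `n p_ε ≤ λ` -/

section Bounds

variable {P : DensityProfile} {e lam : ℝ} {n : ℕ}
  (he : 0 ≤ e) (he2 : e < 1 / 2) (hnp : (n : ℝ) * pOv P e ≤ lam)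
include he he2 hnp

/-- **Tree bound for the shifted coefficients**: `|C(m,i) W¹(i+2)| ≤ p_ε e² (i+1) (eλ)ⁱ` for `i + 1 < n`,
`m ≤ n` (`abs_Wd_le`, `C(m,i) ≤ mⁱ/i!`, `t(i+2) yⁱ/i! ≤ e² (i+1) (ey)ⁱ`, `m p_ε ≤ λ`). [folklore] -/
theorem tlq_abs_coef_succ_le [NeZero n] {m i : ℕ} (hi : i + 1 < n) (hm : m ≤ n) :
    |(m.choose i : ℝ) * Wd P e n (fun _ => 1) (i + 1 + 1)| ≤
      pOv P e * (Real.exp 1 ^ 2 * ((i : ℝ) + 1) * (Real.exp 1 * lam) ^ i) := by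
  have hexp0 : 0 < Real.exp 1 := Real.exp_pos 1
  have hp : 0 ≤ pOv P e := pOv_nonneg P he
  have hW := abs_Wd_le (P := P) (n := n) he he2 (g := fun _ => (1 : ℝ)) measurable_const (C := 1)
    (fun _ => by simp) (k := i + 1 + 1) (by omega) (by omega)
  rw [Nat.add_sub_cancel, one_mul] at hW
  have ht2 : (treeNumber (i + 1 + 1) : ℝ) = treeNumber (i + 2) := rfl
  rw [ht2] at hW
  have hchoose : (m.choose i : ℝ) ≤ (m : ℝ) ^ i / i.factorial := Nat.choose_le_pow_div i m
  have hmp : (m : ℝ) * pOv P e ≤ lam :=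
    le_trans (mul_le_mul_of_nonneg_right (by exact_mod_cast hm) hp) hnp
  have hmp0 : 0 ≤ (m : ℝ) * pOv P e := by positivity
  have ht := treeNumber_succ_succ_mul_pow_div_factorial_le hmp0 i
  have hmono : (Real.exp 1 * ((m : ℝ) * pOv P e)) ^ i ≤ (Real.exp 1 * lam) ^ i :=
    pow_le_pow_left₀ (mul_nonneg hexp0.le hmp0) (mul_le_mul_of_nonneg_left hmp hexp0.le) i
  rw [abs_mul, Nat.abs_cast]
  calc (m.choose i : ℝ) * |Wd P e n (fun _ => 1) (i + 1 + 1)|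
      ≤ ((m : ℝ) ^ i / i.factorial) * (treeNumber (i + 2) * pOv P e ^ (i + 1)) :=
        mul_le_mul hchoose hW (abs_nonneg _) (by positivity)
    _ = pOv P e * ((treeNumber (i + 2) : ℝ) * ((m : ℝ) * pOv P e) ^ i / i.factorial) := by ring
    _ ≤ pOv P e * (Real.exp 1 ^ 2 * (i + 1) * (Real.exp 1 * ((m : ℝ) * pOv P e)) ^ i) :=
        mul_le_mul_of_nonneg_left ht hp
    _ ≤ pOv P e * (Real.exp 1 ^ 2 * ((i : ℝ) + 1) * (Real.exp 1 * lam) ^ i) :=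
        mul_le_mul_of_nonneg_left (mul_le_mul_of_nonneg_left hmono (by positivity)) hp

omit he he2 hnp in
/-- **The increment of the ratio identity** (Pascal's rule): for `m + 1 < n`,
`1/q(m+1) - 1/q(m) = Σ_{j ≤ m} C(m,j) W¹(j+1) [Ξ(m+1-j)/Ξ(m+1) - Ξ(m-j)/Ξ(m)]
  + Σ_{i ≤ m} C(m,i) W¹(i+2) Ξ(m-i)/Ξ(m+1)`. [folklore] -/
theorem tlq_inv_q_sub_eq [NeZero n] {m : ℕ} (hm : m + 1 < n) :
    (Xi P e n (m + 1) / Xi P e n (m + 1 + 1))⁻¹ - (Xi P e n m / Xi P e n (m + 1))⁻¹ =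
      ∑ j ∈ range (m + 1), ((m.choose j : ℝ) * Wd P e n (fun _ => 1) (j + 1)) *
          (Xi P e n (m + 1 - j) / Xi P e n (m + 1) - Xi P e n (m - j) / Xi P e n m) +
        ∑ i ∈ range (m + 1), ((m.choose i : ℝ) * Wd P e n (fun _ => 1) (i + 1 + 1)) *
          (Xi P e n (m + 1 - (i + 1)) / Xi P e n (m + 1)) := by
  rw [gf_inv_q_eq_sum (by omega : m + 1 < n), gf_inv_q_eq_sum (by omega : m < n),
    tlq_pascal_sum m (fun k => Wd P e n (fun _ => 1) k) (fun j => Xi P e n (m + 1 - j) / Xi P e n (m + 1))]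
  rw [add_sub_right_comm, ← sum_sub_distrib]
  exact congrArg₂ (· + ·) (sum_congr rfl fun j _ => by ring) rfl

variable (hlam1 : lam < 1) (hlam2 : lam ≤ 1 / 2)
include hlam1 hlam2

/-- **Increments of the ratio products.** If `|q(k+1) - q(k)| ≤ B/(k+1)` for all `k < m` (`m + 1 ≤ n`), then
`|Ξ(m+1-j)/Ξ(m+1) - Ξ(m-j)/Ξ(m)| ≤ 2ʲ B j (j+1)/(m+1)` for `j ≤ m` (induction on `j` along the recursion
`gf_r_succ`; `1/(m-j) ≤ 4(j+1)/(m+1)` for `j < m`). [folklore] -/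
theorem tlq_abs_r_sub_r_le {m : ℕ} (hm : m + 1 ≤ n) {B : ℝ} (hB : 0 ≤ B)
    (IH : ∀ k < m, |Xi P e n (k + 1) / Xi P e n (k + 2) - Xi P e n k / Xi P e n (k + 1)| ≤ B / ((k : ℝ) + 1)) :
    ∀ {j : ℕ}, j ≤ m →
      |Xi P e n (m + 1 - j) / Xi P e n (m + 1) - Xi P e n (m - j) / Xi P e n m| ≤
        2 ^ j * B * ((j : ℝ) * ((j : ℝ) + 1)) / ((m : ℝ) + 1) := by
  intro j
  induction j with
  | zero =>
      intro _
      rw [gf_r_zero he he2 hnp hlam1 hm, gf_r_zero he he2 hnp hlam1 (by omega : m ≤ n), sub_self, abs_zero]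
      simp
  | succ j ih =>
      intro hj
      have ih' := ih (by omega)
      have hm1 : (0 : ℝ) < (m : ℝ) + 1 := by positivity
      have hj0 : (0 : ℝ) ≤ j := Nat.cast_nonneg j
      have hjm : (j : ℝ) + 1 ≤ m := by exact_mod_cast hj
      -- the induction hypothesis on the insertion ratios at `k = m - 1 - j`
      have hq := IH (m - 1 - j) (by omega)
      have e2 : m - 1 - j + 1 = m - j := by omega
      have hd : ((m - 1 - j : ℕ) : ℝ) + 1 = (m : ℝ) - j := by
        have : ((m - 1 - j : ℕ) : ℝ) + 1 = ((m - 1 - j + 1 : ℕ) : ℝ) := by push_cast; ring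
        rw [this, e2, Nat.cast_sub (by omega : j ≤ m)]
      rw [show m - 1 - j + 2 = m - j + 1 by omega, e2, hd] at hq
      rw [gf_r_succ he he2 hnp hlam1 hm (by omega : j + 1 ≤ m + 1),
        gf_r_succ he he2 hnp hlam1 (by omega : m ≤ n) hj,
        show m + 1 - 1 - j = m - j by omega, e2]
      set r₁ := Xi P e n (m + 1 - j) / Xi P e n (m + 1) with hr₁
      set r₀ := Xi P e n (m - j) / Xi P e n m with hr₀
      set q₁ := Xi P e n (m - j) / Xi P e n (m - j + 1) with hq₁
      set q₀ := Xi P e n (m - 1 - j) / Xi P e n (m - j) with hq₀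
      have hr0 : 0 ≤ r₀ := zero_le_one.trans (gf_one_le_r he he2 hnp hlam1 (by omega : m ≤ n) (by omega))
      have hr2 : r₀ ≤ 2 ^ j := gf_r_le_two_pow he he2 hnp hlam1 hlam2 (by omega : m ≤ n) (by omega)
      have hq0 : 0 ≤ q₁ := zero_le_one.trans (gf_one_le_q he he2 hnp hlam1 (by omega : m - j < n))
      have hq2 : q₁ ≤ 2 := gf_q_le_two he he2 hnp hlam1 hlam2 (by omega : m - j < n)
      have hkey : B / ((m : ℝ) - j) ≤ 4 * B * ((j : ℝ) + 1) / ((m : ℝ) + 1) := by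
        rw [div_le_div_iff₀ (by linarith) hm1]
        have h1 : (m : ℝ) + 1 ≤ 4 * ((j : ℝ) + 1) * ((m : ℝ) - j) := by nlinarith
        calc B * ((m : ℝ) + 1) ≤ B * (4 * ((j : ℝ) + 1) * ((m : ℝ) - j)) :=
              mul_le_mul_of_nonneg_left h1 hB
          _ = 4 * B * ((j : ℝ) + 1) * ((m : ℝ) - j) := by ring
      have hD0 : 0 ≤ 2 ^ j * B * ((j : ℝ) * ((j : ℝ) + 1)) / ((m : ℝ) + 1) :=
        div_nonneg (mul_nonneg (mul_nonneg (pow_nonneg zero_le_two j) hB) (by positivity)) hm1.le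
      calc |r₁ * q₁ - r₀ * q₀| = |(r₁ - r₀) * q₁ + r₀ * (q₁ - q₀)| := by ring_nf
        _ ≤ |(r₁ - r₀) * q₁| + |r₀ * (q₁ - q₀)| := abs_add_le _ _
        _ = |r₁ - r₀| * q₁ + r₀ * |q₁ - q₀| := by
            rw [abs_mul, abs_mul, abs_of_nonneg hq0, abs_of_nonneg hr0]
        _ ≤ 2 ^ j * B * ((j : ℝ) * ((j : ℝ) + 1)) / ((m : ℝ) + 1) * 2 +
              2 ^ j * (4 * B * ((j : ℝ) + 1) / ((m : ℝ) + 1)) :=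
            add_le_add (mul_le_mul ih' hq2 hq0 hD0)
              (mul_le_mul hr2 (hq.trans hkey) (abs_nonneg _) (pow_nonneg zero_le_two j))
        _ = 2 ^ (j + 1) * B * (((j + 1 : ℕ) : ℝ) * (((j + 1 : ℕ) : ℝ) + 1)) / ((m : ℝ) + 1) := by
            push_cast
            ring

/-- **The first sum**: `|Σ_{i ≤ m} C(m,i) W¹(i+2) Ξ(m-i)/Ξ(m+1)| ≤ 2e² p_ε/(1 - 4eλ)` (`m + 1 < n`,
`4eλ < 1`). [folklore] -/
theorem tlq_abs_sum1_le [NeZero n] (hρ1 : 4 * Real.exp 1 * lam < 1) {m : ℕ} (hm : m + 1 < n) :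
    |∑ i ∈ range (m + 1), ((m.choose i : ℝ) * Wd P e n (fun _ => 1) (i + 1 + 1)) *
        (Xi P e n (m + 1 - (i + 1)) / Xi P e n (m + 1))| ≤
      2 * Real.exp 1 ^ 2 * pOv P e / (1 - 4 * Real.exp 1 * lam) := by
  have hexp0 : 0 < Real.exp 1 := Real.exp_pos 1
  have hp : 0 ≤ pOv P e := pOv_nonneg P he
  have hlam0 : 0 ≤ lam := gf_lam_nonneg hnp he
  have hρ0 : 0 ≤ 4 * Real.exp 1 * lam := by positivity
  refine (abs_sum_le_sum_abs _ _).trans ?_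
  have hterm : ∀ i ∈ range (m + 1),
      |((m.choose i : ℝ) * Wd P e n (fun _ => 1) (i + 1 + 1)) *
          (Xi P e n (m + 1 - (i + 1)) / Xi P e n (m + 1))| ≤
        2 * Real.exp 1 ^ 2 * pOv P e * (4 * Real.exp 1 * lam) ^ i := by
    intro i hi
    have him : i ≤ m := Nat.lt_succ_iff.mp (mem_range.mp hi)
    have hr0 : 0 ≤ Xi P e n (m + 1 - (i + 1)) / Xi P e n (m + 1) :=
      zero_le_one.trans (gf_one_le_r he he2 hnp hlam1 (by omega) (by omega))
    have hr2 : Xi P e n (m + 1 - (i + 1)) / Xi P e n (m + 1) ≤ 2 ^ (i + 1) :=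
      gf_r_le_two_pow he he2 hnp hlam1 hlam2 (by omega) (by omega)
    have hc := tlq_abs_coef_succ_le he he2 hnp (m := m) (i := i) (by omega) (by omega)
    have h2p : 0 ≤ 2 * Real.exp 1 ^ 2 * pOv P e := mul_nonneg (by positivity) hp
    rw [abs_mul, abs_of_nonneg hr0]
    calc |(m.choose i : ℝ) * Wd P e n (fun _ => 1) (i + 1 + 1)| *
          (Xi P e n (m + 1 - (i + 1)) / Xi P e n (m + 1))
        ≤ (pOv P e * (Real.exp 1 ^ 2 * ((i : ℝ) + 1) * (Real.exp 1 * lam) ^ i)) * 2 ^ (i + 1) :=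
          mul_le_mul hc hr2 hr0 (mul_nonneg hp (by positivity))
      _ = 2 * Real.exp 1 ^ 2 * pOv P e * (((i : ℝ) + 1) * (2 * Real.exp 1 * lam) ^ i) := by ring
      _ ≤ 2 * Real.exp 1 ^ 2 * pOv P e * (2 * (2 * Real.exp 1 * lam)) ^ i :=
          mul_le_mul_of_nonneg_left (EnskogCompensator.succ_mul_pow_le_two_mul_pow (by positivity) i) h2p
      _ = 2 * Real.exp 1 ^ 2 * pOv P e * (4 * Real.exp 1 * lam) ^ i := by ring
  refine (sum_le_sum hterm).trans ?_
  rw [← mul_sum, div_eq_mul_inv]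
  refine mul_le_mul_of_nonneg_left ?_ (mul_nonneg (by positivity) hp)
  exact sum_le_hasSum (range (m + 1)) (fun i _ => by positivity) (hasSum_geometric_of_lt_one hρ0 hρ1)

/-- **The second sum**: if `|q(k+1) - q(k)| ≤ B/(k+1)` for `k < m` (`m + 1 < n`, `4eλ < 1`), then
`|Σ_{j ≤ m} C(m,j) W¹(j+1) [Ξ(m+1-j)/Ξ(m+1) - Ξ(m-j)/Ξ(m)]| ≤ (e B/(m+1)) · 4eλ/(1-4eλ)²`. [folklore] -/
theorem tlq_abs_sum2_le [NeZero n] (hρ1 : 4 * Real.exp 1 * lam < 1) {m : ℕ} (hm : m + 1 < n) {B : ℝ}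
    (hB : 0 ≤ B)
    (IH : ∀ k < m, |Xi P e n (k + 1) / Xi P e n (k + 2) - Xi P e n k / Xi P e n (k + 1)| ≤ B / ((k : ℝ) + 1)) :
    |∑ j ∈ range (m + 1), ((m.choose j : ℝ) * Wd P e n (fun _ => 1) (j + 1)) *
        (Xi P e n (m + 1 - j) / Xi P e n (m + 1) - Xi P e n (m - j) / Xi P e n m)| ≤
      Real.exp 1 * B / ((m : ℝ) + 1) * (4 * Real.exp 1 * lam / (1 - 4 * Real.exp 1 * lam) ^ 2) := by
  have hexp0 : 0 < Real.exp 1 := Real.exp_pos 1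
  have hlam0 : 0 ≤ lam := gf_lam_nonneg hnp he
  have hρ0 : 0 ≤ 4 * Real.exp 1 * lam := by positivity
  have hm1 : (0 : ℝ) < (m : ℝ) + 1 := by positivity
  have h0 : 0 ≤ Real.exp 1 * B / ((m : ℝ) + 1) := div_nonneg (mul_nonneg hexp0.le hB) hm1.le
  refine (abs_sum_le_sum_abs _ _).trans ?_
  have hterm : ∀ j ∈ range (m + 1),
      |((m.choose j : ℝ) * Wd P e n (fun _ => 1) (j + 1)) *
          (Xi P e n (m + 1 - j) / Xi P e n (m + 1) - Xi P e n (m - j) / Xi P e n m)| ≤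
        Real.exp 1 * B / ((m : ℝ) + 1) * ((j : ℝ) * (4 * Real.exp 1 * lam) ^ j) := by
    intro j hj
    have hjm : j ≤ m := Nat.lt_succ_iff.mp (mem_range.mp hj)
    have hc := gf_abs_coef_le (P := P) he he2 hnp (g := fun _ => (1 : ℝ)) measurable_const (C := 1)
      (fun _ => by simp) (m := m) (j := j) (by omega) (by omega)
    rw [one_mul] at hc
    have hD := tlq_abs_r_sub_r_le he he2 hnp hlam1 hlam2 (by omega : m + 1 ≤ n) hB IH hjm
    have hD0 : 0 ≤ 2 ^ j * B * ((j : ℝ) * ((j : ℝ) + 1)) / ((m : ℝ) + 1) :=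
      div_nonneg (mul_nonneg (mul_nonneg (pow_nonneg zero_le_two j) hB) (by positivity)) hm1.le
    rw [abs_mul]
    calc |(m.choose j : ℝ) * Wd P e n (fun _ => 1) (j + 1)| *
          |Xi P e n (m + 1 - j) / Xi P e n (m + 1) - Xi P e n (m - j) / Xi P e n m|
        ≤ (Real.exp 1 * (Real.exp 1 * lam) ^ j) * (2 ^ j * B * ((j : ℝ) * ((j : ℝ) + 1)) / ((m : ℝ) + 1)) :=
          mul_le_mul hc hD (abs_nonneg _) (by positivity)
      _ = Real.exp 1 * B / ((m : ℝ) + 1) * ((j : ℝ) * (((j : ℝ) + 1) * (2 * Real.exp 1 * lam) ^ j)) := by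
          ring
      _ ≤ Real.exp 1 * B / ((m : ℝ) + 1) * ((j : ℝ) * (2 * (2 * Real.exp 1 * lam)) ^ j) :=
          mul_le_mul_of_nonneg_left (mul_le_mul_of_nonneg_left
            (EnskogCompensator.succ_mul_pow_le_two_mul_pow (by positivity) j) (Nat.cast_nonneg j)) h0
      _ = Real.exp 1 * B / ((m : ℝ) + 1) * ((j : ℝ) * (4 * Real.exp 1 * lam) ^ j) := by ring
  refine (sum_le_sum hterm).trans ?_
  rw [← mul_sum]
  refine mul_le_mul_of_nonneg_left ?_ h0
  have h := hasSum_coe_mul_geometric_of_norm_lt_one (𝕜 := ℝ) (r := 4 * Real.exp 1 * lam)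
    (by rw [Real.norm_eq_abs, abs_of_nonneg hρ0]; exact hρ1)
  exact sum_le_hasSum (range (m + 1)) (fun j _ => by positivity) h

/-- **The induction step.** If `|q(k+1) - q(k)| ≤ B/(k+1)` for all `k < m` (`m + 1 < n`, `4eλ < 1`), then
`|q(m+1) - q(m)| ≤ 4 (2e²λ/(1-4eλ) + 4e²λ B/(1-4eλ)²)/(m+1)`. [folklore] -/
theorem tlq_step [NeZero n] (hρ1 : 4 * Real.exp 1 * lam < 1) {m : ℕ} (hm : m + 1 < n) {B : ℝ} (hB : 0 ≤ B)
    (IH : ∀ k < m, |Xi P e n (k + 1) / Xi P e n (k + 2) - Xi P e n k / Xi P e n (k + 1)| ≤ B / ((k : ℝ) + 1)) :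
    |Xi P e n (m + 1) / Xi P e n (m + 2) - Xi P e n m / Xi P e n (m + 1)| ≤
      4 * (2 * Real.exp 1 ^ 2 * lam / (1 - 4 * Real.exp 1 * lam) +
        4 * Real.exp 1 ^ 2 * lam / (1 - 4 * Real.exp 1 * lam) ^ 2 * B) / ((m : ℝ) + 1) := by
  have hexp0 : 0 < Real.exp 1 := Real.exp_pos 1
  have hp : 0 ≤ pOv P e := pOv_nonneg P he
  have hlam0 : 0 ≤ lam := gf_lam_nonneg hnp he
  have hm1 : (0 : ℝ) < (m : ℝ) + 1 := by positivity
  have hden : 0 < 1 - 4 * Real.exp 1 * lam := by linarith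
  -- `p_ε ≤ λ/(m+1)`
  have hpm : pOv P e ≤ lam / ((m : ℝ) + 1) := by
    rw [le_div_iff₀ hm1]
    have h1 : (m : ℝ) + 1 ≤ n := by exact_mod_cast hm.le
    calc pOv P e * ((m : ℝ) + 1) ≤ pOv P e * n := mul_le_mul_of_nonneg_left h1 hp
      _ = (n : ℝ) * pOv P e := mul_comm _ _
      _ ≤ lam := hnp
  -- the increment of `1/q`
  have hdiff := tlq_inv_q_sub_eq (P := P) (e := e) (n := n) hm
  have hS1 := tlq_abs_sum1_le he he2 hnp hlam1 hlam2 hρ1 hm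
  have hS2 := tlq_abs_sum2_le he he2 hnp hlam1 hlam2 hρ1 hm hB IH
  have hinv : |(Xi P e n (m + 1) / Xi P e n (m + 1 + 1))⁻¹ - (Xi P e n m / Xi P e n (m + 1))⁻¹| ≤
      Real.exp 1 * B / ((m : ℝ) + 1) * (4 * Real.exp 1 * lam / (1 - 4 * Real.exp 1 * lam) ^ 2) +
        2 * Real.exp 1 ^ 2 * pOv P e / (1 - 4 * Real.exp 1 * lam) := by
    rw [hdiff]
    exact (abs_add_le _ _).trans (add_le_add hS2 hS1)
  -- the ratios are in `[1, 2]`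
  have hq₁2 : Xi P e n (m + 1) / Xi P e n (m + 2) ≤ 2 := gf_q_le_two he he2 hnp hlam1 hlam2 hm
  have hq₁1 : 1 ≤ Xi P e n (m + 1) / Xi P e n (m + 2) := gf_one_le_q he he2 hnp hlam1 hm
  have hq₀2 : Xi P e n m / Xi P e n (m + 1) ≤ 2 := gf_q_le_two he he2 hnp hlam1 hlam2 (by omega)
  have hq₀1 : 1 ≤ Xi P e n m / Xi P e n (m + 1) := gf_one_le_q he he2 hnp hlam1 (by omega)
  have h4 := EosUniformGas.abs_sub_le_four_mul_abs_inv_sub_inv (by linarith) hq₁2 (by linarith) hq₀2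
  calc |Xi P e n (m + 1) / Xi P e n (m + 2) - Xi P e n m / Xi P e n (m + 1)|
      ≤ 4 * (Real.exp 1 * B / ((m : ℝ) + 1) * (4 * Real.exp 1 * lam / (1 - 4 * Real.exp 1 * lam) ^ 2) +
          2 * Real.exp 1 ^ 2 * pOv P e / (1 - 4 * Real.exp 1 * lam)) :=
        h4.trans (mul_le_mul_of_nonneg_left hinv (by norm_num))
    _ ≤ 4 * (Real.exp 1 * B / ((m : ℝ) + 1) * (4 * Real.exp 1 * lam / (1 - 4 * Real.exp 1 * lam) ^ 2) +
          2 * Real.exp 1 ^ 2 * (lam / ((m : ℝ) + 1)) / (1 - 4 * Real.exp 1 * lam)) := by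
        have h := div_le_div_of_nonneg_right (mul_le_mul_of_nonneg_left hpm (by positivity :
          (0 : ℝ) ≤ 2 * Real.exp 1 ^ 2)) hden.le
        linarith
    _ = 4 * (2 * Real.exp 1 ^ 2 * lam / (1 - 4 * Real.exp 1 * lam) +
          4 * Real.exp 1 ^ 2 * lam / (1 - 4 * Real.exp 1 * lam) ^ 2 * B) / ((m : ℝ) + 1) := by
        field_simp
        ring

end Bounds

/-! ### The registered stub -/

/-- **LIPSCHITZ DEPENDENCE OF THE INSERTION RATIOS ON THE PARTICLE NUMBER** (registered stub
`tl_insertionRatioLipschitz` of the line `small-tilt-domination`): with `λ₀ = 1/1000` and `B = 1`, for every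
profile `P`, every scale `0 ≤ ε < 1/2`, every `n` with `n p_ε ≤ λ₀` and every `m + 1 < n`,
`|Ξ(m+1)/Ξ(m+2) - Ξ(m)/Ξ(m+1)| ≤ B/(m+1)` (strong induction on `m` with `tlq_step` and `tlq_numerics`).
[cite: PulvirentiTsagkarogiannis2012, §5] -/
theorem tl_insertionRatioLipschitz : InsertionRatioLipschitz := by
  obtain ⟨hρ1, hK⟩ := tlq_numerics
  refine ⟨1 / 1000, by norm_num, 1, one_pos, ?_⟩
  intro P e he he2 n hnp m hm
  haveI : NeZero n := ⟨by omega⟩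
  induction m using Nat.strong_induction_on with
  | _ m ih =>
      have hstep := tlq_step (P := P) he he2 hnp (by norm_num) (by norm_num) hρ1 hm zero_le_one
        (fun k hk => ih k hk (by omega))
      exact hstep.trans (div_le_div_of_nonneg_right hK (by positivity))

end Summit.AtomisticToContinuum.HydrodynamicLimit.Theorems.NearConstantShortTimeHL

end
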